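import Summits.QuantumFields.YangMills.Theorems.AllWindowsColdBoxBoxHighLineStep2Wick
import Summits.QuantumFields.YangMills.Theorems.AllWindowsColdBoxBoxHighLineHaarDensityFlat

/-!
# T-S5.7c `haarTaylor : HaarTaylor` BY NAME — the Haar chart density to fourth order: `log(σ(r)/σ(0)) = log sinc² r = −r²/3 + O(r⁴)` on `[0,1]`
# (STUB-PLAN-S5-STEP2 §3/§8, task file ✓`…Theorems.AllWindowsColdBoxBoxHighLineStep2Wick`; LINE-19 S5 ⟨stmt-QuantumFields-24004⟩/⟨24335⟩)

Width seat `ym-line-sfw-p2-w3` (g40, cell `ym-idea-1`), routed by planner ym-idea-2 g18 (2026-08-29T19:46:09Z «w3: (i) T-S5.7c»).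

**Theorem (`haarTaylor`, constant `C = 1`).**  For `0 ≤ r ≤ 1`: `|log (σ_{SU(2)}(r)/σ_{SU(2)}(0)) + r²/3| ≤ r⁴`, where `σ_{SU(2)} = sigmaSU2` is the printed
Haar density of `SU(2)` in exponential coordinates (`(2π²)⁻¹ (sin r/r)²`, ✓`B10Eq22Rescaling.sigmaSU2`).

Proof: `σ(0) = (2π²)⁻¹` (✓`two_pi_sq_mul_sigmaSU2` at `0`), so `σ(r)/σ(0) = 2π²·σ(r)`, and the bound is w5 g21's ✓`haarDensityFlat_one`
(`|log(2π² σ(t)) + t²/3| ≤ t⁴` on `|t| ≤ 1`, from `Real.sin_bound` and `Real.abs_log_sub_add_sum_range_le`).  A one-line corollary; no definitions;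
standard axioms.  HONEST LABEL: an S-sized brick of STEP 2 of the XL stub S5 (`stub_landauSecondOrder`) of a critic-PASSed DRAFT line; S5, U5,
⟨24004⟩ ⟨24335⟩ ⟨24336⟩ remain OPEN; no crux, rung or summit is proved; **the Yang–Mills mass gap is NOT proved by this file.**
-/

set_option autoImplicit false

noncomputable section

open Literature.MathematicalPhysics.QuantumFieldTheory.Balaban1983to89.B10Eq22Rescaling (sigmaSU2)

namespace Summit.QuantumFields.YangMills.Theorems.AllWindowsColdBoxBoxHighLine

/-- `σ_{SU(2)}(0) = (2π²)⁻¹`. -/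
theorem sigmaSU2_zero_eq : sigmaSU2 0 = (2 * Real.pi ^ 2)⁻¹ := by
  have h := two_pi_sq_mul_sigmaSU2 0
  rw [if_pos rfl, one_pow] at h
  exact eq_inv_of_mul_eq_one_right h

/-- `σ(r)/σ(0) = 2π²·σ(r)`. -/
theorem sigmaSU2_div_sigmaSU2_zero (r : ℝ) : sigmaSU2 r / sigmaSU2 0 = (2 * Real.pi ^ 2) * sigmaSU2 r := by
  rw [sigmaSU2_zero_eq, div_inv_eq_mul, mul_comm]

/-- **T-S5.7c `HaarTaylor`, BY NAME** (constant `C = 1`): `|log(σ(r)/σ(0)) + r²/3| ≤ r⁴` for `0 ≤ r ≤ 1`. -/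
theorem haarTaylor : HaarTaylor := by
  refine ⟨1, fun r h0 h1 => ?_⟩
  rw [sigmaSU2_div_sigmaSU2_zero, one_mul]
  exact haarDensityFlat_one (by rw [abs_of_nonneg h0]; exact h1)

end Summit.QuantumFields.YangMills.Theorems.AllWindowsColdBoxBoxHighLine

end
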